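import Literature.AlgebraicGeometry.Frobenioids.DivisorMonoidCategoryTheoreticity
import HarnessLib

/-!
# [FrdI] Theorem 4.9, proof p. 89: descent of `Ψ^Φ` along an embedding of divisor monoids `Φ ↪ Φ'`
# ("by passing to perfections … we may assume … perfect type" / "maps the subset `Φ₁(A₁) ⊆ Φ₁(A₁)^pf`
# onto the subset `Φ₂(A₂)`") — a generic transport principle, PROVED

Mochizuki, *The geometry of Frobenioids I: the general theory*, Kyushu J. Math. **62** (2008) 293–400,
§4, proof of Theorem 4.9, kurims text p. 89 ll. 25–33 and ll. 38–41 [cite: MochizukiFrdI2008, Thm. 4.9 p.89]: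

> "one concludes immediately that this [isomorphism] maps the subset `Φ₁(A₁) ⊆ Φ₁(A₁)^pf_factor` onto the
> subset `Φ₂(A₂) ⊆ Φ₂(A₂)^pf_factor`, hence determines an isomorphism of monoids `Φ₁(A₁) ⥲ Φ₂(A₂)` which
> is functorial in `A₁`" … "by passing to perfections [cf. Theorem 3.4, (iii)], we may assume without loss
> of generality that `C₁`, `C₂` are of perfect type [cf. also Proposition 5.5, (iii), below]."

PROOF-ONLY support file (seat abc-iut-w4-d109; S5 sub-DAG [FrdI] Thm. 4.9, the formal part of rows
T49-L03/T49-L05 needed to DESCEND the conclusion of Thm. 4.9 — abc-iut-L1-t3's closing shape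
`PreFrobenioidData.DivisorMonoidIsoOver S₁ S₂ Ψ` — from auxiliary data with LARGER divisor monoids, e.g. from
the perfections `C_i^pf → F_{Φ_i^pf}` with `Φ_i ↪ Φ_i^pf`, to the `C_i → F_{Φ_i}` themselves), generic over
abc-iut-L1-t3's operations `S_i : PreFrobenioidData C_i D_i`:

* `PreFrobenioidData.DivisorMonoidIsoOver.nonempty_of_embedding` — given operations `S_i'` on categories
  `C_i'` over the SAME bases `D_i`, a functor `I₁ : C₁ → C₁'` lying over the base (`b_A : Base₁'(I₁ A) ≅
  Base₁ A`, natural in `A`; "`C → C^pf` lies over `D`"), an equivalence `Ψ' : C₁' ⥲ C₂'` whose values on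
  `I₁` lie over those of `Ψ` (`g_A : Base₂'(Ψ' I₁ A) ≅ Base₂(Ψ A)`, natural in `A`; e.g. from
  `I₁ ⋙ Ψ' ≅ Ψ ⋙ I₂`, Thm. 3.4 (iii), and `Base₂' ∘ I₂ ≅ Base₂`), componentwise-injective monoid maps
  `ι_i : Φ_i(X) → Φ_i'(X)` natural in `X ∈ Ob(D_i)` ("`Φ ⊆ Φ^pf`"), and an isomorphism of functors
  `Φ₁' ⥲ Φ₂'` over `Ψ'` on the `C_i'` which, at every `A ∈ Ob(C₁)` (read through `b_A`, `g_A`), maps the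
  image of `ι₁` ONTO the image of `ι₂` — there is an isomorphism of functors `Ψ^Φ : Φ₁ ⥲ Φ₂` lying over
  `Ψ` on the `C_i`.
For THE perfections (`PreFrobenioidData.perfection hF_i`, seat abc-iut-L1-d9) the hypotheses are met with
`I_i := toPf`, `b_A := Iso.refl _` (the base objects agree definitionally; naturality = `baseMap_toPf`),
`ι_i := Perfection.of` (natural with respect to pull-backs by `rfl`; injective for divisorial `Φ_i`,
`Perfection.of_injective_of_isSharp_isIntegral_isSaturated`), `g_A` from the `1`-commutation
`toPf₁ ⋙ Ψ^pf ≅ Ψ ⋙ toPf₂` (Thm. 3.4 (iii)), and the image condition = row T49-L03 ("`Φ₁(A₁) ⊆ Φ₁(A₁)^pf` onto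
`Φ₂(A₂)`"). Pure transport (no Frobenioid axiom is used); no new definitions; nothing of [FrdI] restated; nothing here
bears on [IUTchIII] Cor. 3.12.
-/

namespace Literature.AlgebraicGeometry.Frobenioids

open CategoryTheory Opposite

universe w₁ w₂ w₁' w₂' v₁ v₁' v₂ v₂' u₁ u₁' u₂ u₂' v₃ u₃ v₄ u₄

namespace PreFrobenioidData

namespace DivisorMonoidIsoOver

variable {C₁ : Type u₁} [Category.{v₁} C₁] {D₁ : Type u₁'} [Category.{v₁'} D₁]
variable {C₂ : Type u₂} [Category.{v₂} C₂] {D₂ : Type u₂'} [Category.{v₂'} D₂]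
variable {C₁' : Type u₃} [Category.{v₃} C₁'] {C₂' : Type u₄} [Category.{v₄} C₂']
variable {S₁ : PreFrobenioidData.{w₁} C₁ D₁} {S₂ : PreFrobenioidData.{w₂} C₂ D₂} {Ψ : C₁ ≌ C₂}
variable {S₁' : PreFrobenioidData.{w₁'} C₁' D₁} {S₂' : PreFrobenioidData.{w₂'} C₂' D₂} {Ψ' : C₁' ≌ C₂'}

/-- **Descent of `Ψ^Φ` along an embedding of divisor monoids** (the formal content of "maps the subset
`Φ₁(A₁) ⊆ Φ₁(A₁)^pf` onto the subset `Φ₂(A₂)`, hence determines an isomorphism of monoids `Φ₁(A₁) ⥲ Φ₂(A₂)`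
which is functorial in `A₁`", FrdI p. 89, together with "by passing to perfections … we may assume … perfect
type"): let `I₁ : C₁ → C₁'` be a functor lying over the base (`b_A : Base₁'(I₁ A) ≅ Base₁(A)`, natural in
`A`), `Ψ' : C₁' ⥲ C₂'` an equivalence whose values on `I₁` lie over those of `Ψ` (`g_A : Base₂'(Ψ' I₁ A) ≅
Base₂(Ψ A)`, natural in `A` — e.g. from `I₁ ⋙ Ψ' ≅ Ψ ⋙ I₂` and `Base₂' ∘ I₂ ≅ Base₂`), `ι_i : Φ_i → Φ_i'`
componentwise-injective monoid maps natural with respect to pull-backs, and `E'` an isomorphism of functors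
`Φ₁' ⥲ Φ₂'` over `Ψ'` on the `C_i'`. If at every `A ∈ Ob(C₁)` the component `E'_{I₁ A}` — read on `Φ₁'(Base₁ A)`
and `Φ₂'(Base₂ Ψ A)` through `b_A`, `g_A` — maps the image of `ι₁` ONTO the image of `ι₂`, then there is an
isomorphism of functors `Ψ^Φ : Φ₁ ⥲ Φ₂` lying over `Ψ` on the `C_i` (its components are the restrictions of
those of `E'`). [cite: MochizukiFrdI2008, Thm. 4.9 p.89] -/
theorem nonempty_of_embedding (I₁ : C₁ ⥤ C₁')
    (b : ∀ A : C₁, S₁'.base.obj (I₁.obj A) ≅ S₁.base.obj A)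
    (hb : ∀ ⦃A B : C₁⦄ (φ : A ⟶ B), (b A).hom ≫ S₁.base.map φ = S₁'.base.map (I₁.map φ) ≫ (b B).hom)
    (g : ∀ A : C₁, S₂'.base.obj (Ψ'.functor.obj (I₁.obj A)) ≅ S₂.base.obj (Ψ.functor.obj A))
    (hg : ∀ ⦃A B : C₁⦄ (φ : A ⟶ B), (g A).hom ≫ S₂.base.map (Ψ.functor.map φ) =
      S₂'.base.map (Ψ'.functor.map (I₁.map φ)) ≫ (g B).hom)
    (ι₁ : ∀ X : D₁, S₁.Mon X →* S₁'.Mon X)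
    (hι₁ : ∀ ⦃X Y : D₁⦄ (f : Y ⟶ X) (x : S₁.Mon X), ι₁ Y (S₁.pull f x) = S₁'.pull f (ι₁ X x))
    (hι₁inj : ∀ X : D₁, Function.Injective (ι₁ X))
    (ι₂ : ∀ X : D₂, S₂.Mon X →* S₂'.Mon X)
    (hι₂ : ∀ ⦃X Y : D₂⦄ (f : Y ⟶ X) (x : S₂.Mon X), ι₂ Y (S₂.pull f x) = S₂'.pull f (ι₂ X x))
    (hι₂inj : ∀ X : D₂, Function.Injective (ι₂ X))
    (E' : DivisorMonoidIsoOver S₁' S₂' Ψ')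
    (himg : ∀ A : C₁,
      (∀ x : S₁.Mon (S₁.base.obj A), ∃ z : S₂.Mon (S₂.base.obj (Ψ.functor.obj A)),
          E'.iso (I₁.obj A) (S₁'.pull (b A).hom (ι₁ _ x)) = S₂'.pull (g A).hom (ι₂ _ z)) ∧
      (∀ z : S₂.Mon (S₂.base.obj (Ψ.functor.obj A)), ∃ x : S₁.Mon (S₁.base.obj A),
          E'.iso (I₁.obj A) (S₁'.pull (b A).hom (ι₁ _ x)) = S₂'.pull (g A).hom (ι₂ _ z))) :
    Nonempty (DivisorMonoidIsoOver S₁ S₂ Ψ) := by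
  classical
  -- the two injective transports into `Φ₂'(Base₂'(Ψ' I₁ A))`
  let t₁ : ∀ A : C₁, S₁.Mon (S₁.base.obj A) → S₂'.Mon (S₂'.base.obj (Ψ'.functor.obj (I₁.obj A))) :=
    fun A x => E'.iso (I₁.obj A) (S₁'.pull (b A).hom (ι₁ _ x))
  let t₂ : ∀ A : C₁, S₂.Mon (S₂.base.obj (Ψ.functor.obj A)) →
      S₂'.Mon (S₂'.base.obj (Ψ'.functor.obj (I₁.obj A))) :=
    fun A z => S₂'.pull (g A).hom (ι₂ _ z)
  have t₁_mul : ∀ (A : C₁) (x y : S₁.Mon (S₁.base.obj A)), t₁ A (x * y) = t₁ A x * t₁ A y := by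
    intro A x y
    simp only [t₁, map_mul]
  have t₂_mul : ∀ (A : C₁) (x y : S₂.Mon (S₂.base.obj (Ψ.functor.obj A))),
      t₂ A (x * y) = t₂ A x * t₂ A y := by
    intro A x y
    simp only [t₂, map_mul]
  -- pull-back along an isomorphism is injective
  have pinj₁ : ∀ {X Y : D₁} (i : Y ≅ X), Function.Injective (S₁'.pull i.hom) := by
    intro X Y i u v h
    have := congrArg (S₁'.pull i.inv) h
    rwa [← S₁'.pull_comp, ← S₁'.pull_comp, i.inv_hom_id, S₁'.pull_id, S₁'.pull_id] at this
  have pinj₂ : ∀ {X Y : D₂} (i : Y ≅ X), Function.Injective (S₂'.pull i.hom) := by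
    intro X Y i u v h
    have := congrArg (S₂'.pull i.inv) h
    rwa [← S₂'.pull_comp, ← S₂'.pull_comp, i.inv_hom_id, S₂'.pull_id, S₂'.pull_id] at this
  have t₁_inj : ∀ A : C₁, Function.Injective (t₁ A) := by
    intro A u v h
    exact hι₁inj _ (pinj₁ (b A) ((E'.iso (I₁.obj A)).injective h))
  have t₂_inj : ∀ A : C₁, Function.Injective (t₂ A) := by
    intro A u v h
    exact hι₂inj _ (pinj₂ (g A) h)
  -- the component `Ψ^Φ_A` as a function and its inverse, from the image condition
  let f : ∀ A : C₁, S₁.Mon (S₁.base.obj A) → S₂.Mon (S₂.base.obj (Ψ.functor.obj A)) :=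
    fun A x => ((himg A).1 x).choose
  have hf : ∀ (A : C₁) (x : S₁.Mon (S₁.base.obj A)), t₂ A (f A x) = t₁ A x :=
    fun A x => (((himg A).1 x).choose_spec).symm
  let fi : ∀ A : C₁, S₂.Mon (S₂.base.obj (Ψ.functor.obj A)) → S₁.Mon (S₁.base.obj A) :=
    fun A z => ((himg A).2 z).choose
  have hfi : ∀ (A : C₁) (z : S₂.Mon (S₂.base.obj (Ψ.functor.obj A))), t₁ A (fi A z) = t₂ A z :=
    fun A z => ((himg A).2 z).choose_spec
  let e : ∀ A : C₁, S₁.Mon (S₁.base.obj A) ≃* S₂.Mon (S₂.base.obj (Ψ.functor.obj A)) := fun A =>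
    { toFun := f A
      invFun := fi A
      left_inv := fun x => t₁_inj A (by rw [hfi, hf])
      right_inv := fun z => t₂_inj A (by rw [hf, hfi])
      map_mul' := fun x y => t₂_inj A (by rw [hf, t₁_mul, t₂_mul, hf, hf]) }
  refine ⟨⟨e, fun A B φ x => ?_⟩⟩
  -- naturality, checked after the injective transport `t₂ A`
  show f A (S₁.pull (S₁.base.map φ) x) = S₂.pull (S₂.base.map (Ψ.functor.map φ)) (f B x)
  apply t₂_inj A
  rw [hf]
  -- left-hand side: `E'_{I₁A}(b_A^* ι₁(Base(φ)^* x)) = Base₂'(Ψ' I₁ φ)^* E'_{I₁B}(b_B^* ι₁ x)`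
  have lhs : t₁ A (S₁.pull (S₁.base.map φ) x) =
      S₂'.pull (S₂'.base.map (Ψ'.functor.map (I₁.map φ))) (t₁ B x) := by
    simp only [t₁]
    rw [hι₁, ← S₁'.pull_comp, hb, S₁'.pull_comp]
    exact E'.natural (I₁.map φ) _
  -- right-hand side: `g_A^* ι₂(Base₂(Ψ φ)^* f_B x) = Base₂'(Ψ' I₁ φ)^* g_B^* ι₂(f_B x)`
  have rhs : t₂ A (S₂.pull (S₂.base.map (Ψ.functor.map φ)) (f B x)) =
      S₂'.pull (S₂'.base.map (Ψ'.functor.map (I₁.map φ))) (t₂ B (f B x)) := by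
    simp only [t₂]
    rw [hι₂, ← S₂'.pull_comp, hg, S₂'.pull_comp]
  rw [lhs, rhs, hf]

/-- The same with the base identification `g_A` ASSEMBLED from a `1`-commutation `sq : I₁ ⋙ Ψ' ≅ Ψ ⋙ I₂`
(Thm. 3.4 (iii): "`Ψ^pf ∘ (C₁ → C₁^pf) ≅ (C₂ → C₂^pf) ∘ Ψ`") and a functor `I₂ : C₂ → C₂'` lying over the base
(`β₂ : I₂ ⋙ Base₂' ≅ Base₂`): `g_A := Base₂'(sq_A) ≫ β₂_{Ψ A}`. [cite: MochizukiFrdI2008, Thm. 4.9 p.89] -/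
theorem nonempty_of_embedding_of_square (I₁ : C₁ ⥤ C₁') (I₂ : C₂ ⥤ C₂')
    (sq : I₁ ⋙ Ψ'.functor ≅ Ψ.functor ⋙ I₂)
    (β₁ : I₁ ⋙ S₁'.base ≅ S₁.base) (β₂ : I₂ ⋙ S₂'.base ≅ S₂.base)
    (ι₁ : ∀ X : D₁, S₁.Mon X →* S₁'.Mon X)
    (hι₁ : ∀ ⦃X Y : D₁⦄ (f : Y ⟶ X) (x : S₁.Mon X), ι₁ Y (S₁.pull f x) = S₁'.pull f (ι₁ X x))
    (hι₁inj : ∀ X : D₁, Function.Injective (ι₁ X))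
    (ι₂ : ∀ X : D₂, S₂.Mon X →* S₂'.Mon X)
    (hι₂ : ∀ ⦃X Y : D₂⦄ (f : Y ⟶ X) (x : S₂.Mon X), ι₂ Y (S₂.pull f x) = S₂'.pull f (ι₂ X x))
    (hι₂inj : ∀ X : D₂, Function.Injective (ι₂ X))
    (E' : DivisorMonoidIsoOver S₁' S₂' Ψ')
    (himg : ∀ A : C₁,
      (∀ x : S₁.Mon (S₁.base.obj A), ∃ z : S₂.Mon (S₂.base.obj (Ψ.functor.obj A)),
          E'.iso (I₁.obj A) (S₁'.pull (β₁.hom.app A) (ι₁ _ x)) =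
            S₂'.pull (S₂'.base.map (sq.hom.app A) ≫ β₂.hom.app (Ψ.functor.obj A)) (ι₂ _ z)) ∧
      (∀ z : S₂.Mon (S₂.base.obj (Ψ.functor.obj A)), ∃ x : S₁.Mon (S₁.base.obj A),
          E'.iso (I₁.obj A) (S₁'.pull (β₁.hom.app A) (ι₁ _ x)) =
            S₂'.pull (S₂'.base.map (sq.hom.app A) ≫ β₂.hom.app (Ψ.functor.obj A)) (ι₂ _ z))) :
    Nonempty (DivisorMonoidIsoOver S₁ S₂ Ψ) := by
  -- the natural isomorphism `G : Base₂' ∘ Ψ' ∘ I₁ ≅ Base₂ ∘ Ψ` assembled from `sq` and `β₂`; its components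
  -- are `Base₂'(sq_A) ≫ β₂_{Ψ A}` definitionally
  let G : (I₁ ⋙ Ψ'.functor) ⋙ S₂'.base ≅ Ψ.functor ⋙ S₂.base :=
    Functor.isoWhiskerRight sq S₂'.base ≪≫ Functor.isoWhiskerLeft Ψ.functor β₂
  exact nonempty_of_embedding I₁ (fun A => β₁.app A) (fun A B φ => (β₁.hom.naturality φ).symm)
    (fun A => G.app A) (fun A B φ => (G.hom.naturality φ).symm) ι₁ hι₁ hι₁inj ι₂ hι₂ hι₂inj E' himg

end DivisorMonoidIsoOver

end PreFrobenioidData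

end Literature.AlgebraicGeometry.Frobenioids
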